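import Summits.AtomisticToContinuum.BoseEinsteinCondensation.Theorems.BECThomsonPrincipleGDTransferSeededSpectralDefs
import Summits.AtomisticToContinuum.BoseEinsteinCondensation.Theorems.BECProbeMassFlowCloudMomentumAtomFixedN

/-!
# Route `BECThomsonPrinciple`, crux `GDTransfer` (stmt-AtomisticToContinuum-9482), line `seeded-continuity`:
# spectral seed programme — sanity of the gap floor: `KyFanGapFloorFor 0`

Supports (does not close) stmt-AtomisticToContinuum-9482: proves the registered sub-goal
`kyFanGapFloorFor_zero : KyFanGapFloorFor 0` of the lead's seventh Defs file `…SeededSpectralDefs` — the FREE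
gas satisfies the Ky Fan gap floor `2E₀(N, L) + K/L³ ≤ kyFanTwo(N, L)` on the dilute path, for every `K > 0`.

**Proof.**  At `v = 0` the periodic ground-state energy vanishes (constant trial state,
`periodicGroundStateEnergy_zero_eq_zero`), and the Ky Fan two-sum is bounded below by the free torus gap,
`(2π/L)² ≤ kyFanTwo 0 N L` (`CloudMomentumAtom.Birth.ofReal_sq_le_kyFanTwo_zero`: Poincaré–Wirtinger on
`cell^N` for each state of an `L²`-orthogonal pair plus Bessel for the constant mode).  On the dilute path with
`ρ₀ = 1` and `N₀ = ⌈(K/(4π²))³⌉₊` one has `(K/(4π²))³ ≤ N₀ ≤ N ≤ L³`, so `K/(4π²) ≤ L`, i.e.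
`K/L³ ≤ 4π²/L² = (2π/L)²`.

References: LiebLoss2001 Thm 8.11 (Poincaré); LSSY2005 App. A (A.10); ReedSimonIV1978 Thm XIII.1–2 (Ky Fan).
-/

noncomputable section

open MeasureTheory Filter
open scoped ENNReal NNReal ComplexConjugate

namespace Summit.AtomisticToContinuum.BoseEinsteinCondensation.Cruxes.GDTransfer.Seeded

open Literature.MathematicalPhysics.QuantumManyBody.BoseGas
open Summit.AtomisticToContinuum.BoseEinsteinCondensation.Cruxes.CloudMomentumAtom.Birth
  (ofReal_sq_le_kyFanTwo_zero)

/-- Pure real arithmetic of the dilute path at `v = 0`: if `(K/(4π²))³ ≤ L³` with `L > 0` then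
`K/L³ ≤ (2π/L)²`. [folklore] -/
theorem div_cube_le_freeGap {K L : ℝ} (hL : 0 < L) (h : (K / (4 * Real.pi ^ 2)) ^ 3 ≤ L ^ 3) :
    K / L ^ 3 ≤ (2 * Real.pi / L) ^ 2 := by
  have hπ : 0 < 4 * Real.pi ^ 2 := by positivity
  have hc : K / (4 * Real.pi ^ 2) ≤ L := le_of_pow_le_pow_left₀ (by norm_num) hL.le h
  have hK : K ≤ 4 * Real.pi ^ 2 * L := by
    rw [div_le_iff₀ hπ] at hc
    linarith
  rw [div_pow, div_le_div_iff₀ (by positivity) (by positivity)]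
  calc K * L ^ 2 ≤ 4 * Real.pi ^ 2 * L * L ^ 2 := mul_le_mul_of_nonneg_right hK (by positivity)
    _ = (2 * Real.pi) ^ 2 * L ^ 3 := by ring

/-- **The free gas satisfies the Ky Fan gap floor** (sanity of `KyFanGapFloorFor`): for `v = 0`, every `K > 0`,
`ρ₀ = 1`, `N₀ = ⌈(K/(4π²))³⌉₊`, along the dilute path `N₀ ≤ N ≤ L³` one has
`2E₀(N, L) + K/L³ = K/L³ ≤ (2π/L)² ≤ kyFanTwo 0 N L` — the torus Poincaré inequality in Ky Fan form.
[cite: LiebLoss2001, Thm. 8.11; LSSY2005, App. A (A.10)] -/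
theorem kyFanGapFloorFor_zero : KyFanGapFloorFor 0 := by
  intro K _hK
  refine ⟨1, one_pos, ⌈(K / (4 * Real.pi ^ 2)) ^ 3⌉₊, fun m hm L hL hpath => ?_⟩
  have hcube : (K / (4 * Real.pi ^ 2)) ^ 3 ≤ L ^ 3 :=
    calc (K / (4 * Real.pi ^ 2)) ^ 3 ≤ (⌈(K / (4 * Real.pi ^ 2)) ^ 3⌉₊ : ℝ) := Nat.le_ceil _
      _ ≤ ((m + 1 : ℕ) : ℝ) := by exact_mod_cast hm
      _ ≤ 1 * L ^ 3 := hpath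
      _ = L ^ 3 := one_mul _
  rw [periodicGroundStateEnergy_zero_eq_zero (m + 1) hL, mul_zero, zero_add]
  exact (ENNReal.ofReal_le_ofReal (div_cube_le_freeGap hL hcube)).trans
    (ofReal_sq_le_kyFanTwo_zero hL (m + 1))

end Summit.AtomisticToContinuum.BoseEinsteinCondensation.Cruxes.GDTransfer.Seeded

end
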